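import Literature.MathematicalPhysics.QuantumFieldTheory.Federbush1986.PhaseCellIVThmA1Large

/-!
# Federbush, *A phase cell approach to Yang–Mills theory. IV. The choice of variables* (CMP **114** (1988) 317–343) —
# §11 Geometric Construction 3, (11.7)–(11.8) p. 338 (= Theorem A.1 on a hypercube of side `L_r`, with the p. 339 «Caution»),
# TYPED at every scale and PROVED (embedded reading) for every compact uniformly Lipschitz-retractable `M ⊆ Rᵗ` and for `S^{t−1}`

statement-level skeleton of published theorems with citation tags; proofs where landed; nothing here is a claim about the Yang–Mills mass gap

Cell `lit-balaban`, reader/typer block **r19** (F4 fold owner), inventory row `F4.Def§11` (§11 Gauge interpolation, Geometric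
Constructions 1–6) of `run/shared/lean/pub/lit-balaban/lit-balaban-r19/ROWS-F4.md`; companion of `PhaseCellIVGeomConstructions`
(Constructions 1, 2; p264612), `PhaseCellIVGeomConstruction4` (Construction 4 = Theorem A.2 on the cube; p266275) and
`PhaseCellIVThmA1Large` (Theorem A.1 at every cap; p299105).

**Source.** P. Federbush, Commun. Math. Phys. **114** (1988) 317–343 [bib `Federbush1988PhaseCellIV`; doi:10.1007/bf01225039;
lit store `paper:doi-10-1007-bf01225039`; journal page = PDF page + 316], p. 338 [PDF 22] and p. 339 [PDF 23] read as images
(renders `lit-balaban-r19/renders/f4/f4-p022.png`, `f4-p023.png`).  Verbatim, p. 338: «We now go to the inductive step from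
edge (or surface) to surface (or volume).  We denote this as the extension from `∂D` to `D`.  We let `H₁` be the hypercube
containing `∂D` of lowest depth.  We extend `φ′₁(x)` defined on `∂D` to `ᵉφ′₁(x)` defined on `D`.  *Geometric Construction 3.*
This extension satisfies a) `ᵉφ′₁(x) = φ′₁(x)` (11.7), b) `Λ₁(ᵉφ′₁) ≤ cΛ₁(φ′₁)` (11.8) (But see caution at end of this
section.) … If the mapping `φ′ : ∂H → G` (11.9) is homotopically trivial we will use the same *Geometric Construction 3* to
accomplish an extension `ᵉφ′` to all of `H` satisfying (11.7) and (11.8).»  p. 339: «*Caution.* The geometric theorems of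
Appendix A, require a universal bound on `Λ₁` of `φ`'s (as scaled to unit scale), to get started.»

**What this file does.**
* `scaledCube k ℓ` / `scaledCubeBoundary k ℓ`: the hypercube `D_ℓ = {0 ≤ x_i ≤ ℓ}` of side `ℓ = L_r` in `ℝᵏ` and its boundary,
  with the dictionary «as scaled to unit scale» (`GeomConstr3.mem_scaledCube(_Boundary)_iff`: `x ∈ D_ℓ ↔ ℓ⁻¹x ∈ D`, the
  boundary through the homeomorphism `x ↦ ℓ⁻¹x`).
* `GeomConstruction3 k t M`: (11.7)–(11.8) with the Caution built in — for every cap `c₁` a constant `c(c₁)` such that every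
  homotopically trivial `φ′₁ : ∂D_ℓ → M` with `ℓ·Λ₁(φ′₁) ≤ c₁` (the scale-invariant form of (A.1)) extends to `D_ℓ` with
  `Λ₁(ᵉφ′₁) ≤ cΛ₁(φ′₁)`; embedded reading (target a set `M ⊆ Rᵗ` with the ambient distance), as every App. A file.
* `geomConstruction3_of_thmA1Emb : ThmA1Emb k t M → GeomConstruction3 k t M` (same constant; transport along the dilations
  `y ↦ ℓy`, `x ↦ ℓ⁻¹x`, under which `Λ₁` scales by `ℓ` and `ℓ⁻¹` and homotopic triviality is preserved), hence
  `geomConstruction3_of_retract` (every compact uniformly Lipschitz-retractable `M`, by p299105) and `geomConstruction3_sphere`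
  (hypothesis-free).
-/

namespace Literature.MathematicalPhysics.QuantumFieldTheory.Federbush1986

noncomputable section

open scoped NNReal ENNReal
open Set Metric

namespace PhaseCellIVAppA

/-! ## 1. The hypercube of side `ℓ = L_r` and its boundary -/

/-- The `k`-cube of side `ℓ`, `D_ℓ = {0 ≤ x_i ≤ ℓ}` — a hypercube `H` of level `r`, `ℓ = L_r` (§1; p. 338 «We let `H₁` be the
hypercube containing `∂D` of lowest depth»), inside `ℝᵏ` with the Euclidean distance.
[cite: Federbush1988PhaseCellIV, Geometric Construction 3 p. 338; §1 p. 321] -/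
def scaledCube (k : ℕ) (ℓ : ℝ) : Set (EuclideanSpace ℝ (Fin k)) := {x | ∀ i, x i ∈ Icc (0 : ℝ) ℓ}

/-- `∂D_ℓ`, the boundary of the cube of side `ℓ` («We extend `φ′₁(x)` defined on `∂D` to `ᵉφ′₁(x)` defined on `D`», p. 338).
[cite: Federbush1988PhaseCellIV, Geometric Construction 3 (11.7) p. 338] -/
def scaledCubeBoundary (k : ℕ) (ℓ : ℝ) : Set (EuclideanSpace ℝ (Fin k)) := frontier (scaledCube k ℓ)

/-- `D_ℓ` is closed. [cite: Federbush1988PhaseCellIV, Geometric Construction 3 p. 338] -/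
theorem isClosed_scaledCube (k : ℕ) (ℓ : ℝ) : IsClosed (scaledCube k ℓ) := by
  have : scaledCube k ℓ = ⋂ i, (fun x : EuclideanSpace ℝ (Fin k) => x i) ⁻¹' Icc (0 : ℝ) ℓ := by
    ext x; simp [scaledCube]
  rw [this]
  exact isClosed_iInter fun i => isClosed_Icc.preimage (by fun_prop)

/-- `∂D_ℓ ⊆ D_ℓ`. [cite: Federbush1988PhaseCellIV, Geometric Construction 3 (11.7) p. 338] -/
theorem scaledCubeBoundary_subset (k : ℕ) (ℓ : ℝ) : scaledCubeBoundary k ℓ ⊆ scaledCube k ℓ :=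
  frontier_subset_closure.trans (isClosed_scaledCube k ℓ).closure_subset

namespace GeomConstr3

/-- «as scaled to unit scale» (p. 339): `x ∈ D_ℓ ↔ ℓ⁻¹x ∈ D`. [cite: Federbush1988PhaseCellIV, §11 Caution p. 339] -/
theorem mem_scaledCube_iff {k : ℕ} {ℓ : ℝ} (hℓ : 0 < ℓ) (x : EuclideanSpace ℝ (Fin k)) :
    x ∈ scaledCube k ℓ ↔ ℓ⁻¹ • x ∈ unitCube k := by
  simp only [scaledCube, unitCube, mem_setOf_eq, PiLp.smul_apply, smul_eq_mul, mem_Icc]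
  refine forall_congr' fun i => ?_
  rw [mul_nonneg_iff_of_pos_left (inv_pos.mpr hℓ), inv_mul_le_one₀ hℓ]

/-- The scaled cube is the preimage of the unit cube under the dilation `x ↦ ℓ⁻¹x`.
[cite: Federbush1988PhaseCellIV, §11 Caution p. 339] -/
theorem scaledCube_eq_preimage {k : ℕ} {ℓ : ℝ} (hℓ : 0 < ℓ) :
    scaledCube k ℓ = (fun x : EuclideanSpace ℝ (Fin k) => ℓ⁻¹ • x) ⁻¹' unitCube k :=
  Set.ext fun x => mem_scaledCube_iff hℓ x

/-- «as scaled to unit scale»: `x ∈ ∂D_ℓ ↔ ℓ⁻¹x ∈ ∂D` (the dilation is a homeomorphism of `ℝᵏ`).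
[cite: Federbush1988PhaseCellIV, §11 Caution p. 339] -/
theorem mem_scaledCubeBoundary_iff {k : ℕ} {ℓ : ℝ} (hℓ : 0 < ℓ) (x : EuclideanSpace ℝ (Fin k)) :
    x ∈ scaledCubeBoundary k ℓ ↔ ℓ⁻¹ • x ∈ cubeBoundary k := by
  set h : EuclideanSpace ℝ (Fin k) ≃ₜ EuclideanSpace ℝ (Fin k) := Homeomorph.smulOfNeZero ℓ⁻¹ (inv_ne_zero hℓ.ne') with hh
  have h1 : scaledCube k ℓ = h ⁻¹' unitCube k := scaledCube_eq_preimage hℓ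
  rw [scaledCubeBoundary, h1, ← Homeomorph.preimage_frontier, cubeBoundary]
  rfl

/-- Converse direction: `y ∈ D ↔ ℓy ∈ D_ℓ`. [cite: Federbush1988PhaseCellIV, §11 Caution p. 339] -/
theorem smul_mem_scaledCube_iff {k : ℕ} {ℓ : ℝ} (hℓ : 0 < ℓ) (y : EuclideanSpace ℝ (Fin k)) :
    ℓ • y ∈ scaledCube k ℓ ↔ y ∈ unitCube k := by
  rw [mem_scaledCube_iff hℓ, smul_smul, inv_mul_cancel₀ hℓ.ne', one_smul]

/-- Converse direction on the boundary: `y ∈ ∂D ↔ ℓy ∈ ∂D_ℓ`. [cite: Federbush1988PhaseCellIV, §11 Caution p. 339] -/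
theorem smul_mem_scaledCubeBoundary_iff {k : ℕ} {ℓ : ℝ} (hℓ : 0 < ℓ) (y : EuclideanSpace ℝ (Fin k)) :
    ℓ • y ∈ scaledCubeBoundary k ℓ ↔ y ∈ cubeBoundary k := by
  rw [mem_scaledCubeBoundary_iff hℓ, smul_smul, inv_mul_cancel₀ hℓ.ne', one_smul]

end GeomConstr3

/-! ## 2. Geometric Construction 3, (11.7)–(11.8), typed at every scale with the «Caution» built in -/

/-- **Geometric Construction 3** p. 338: «We extend `φ′₁(x)` defined on `∂D` to `ᵉφ′₁(x)` defined on `D`.  *Geometric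
Construction 3.* This extension satisfies a) `ᵉφ′₁(x) = φ′₁(x)` (11.7), b) `Λ₁(ᵉφ′₁) ≤ cΛ₁(φ′₁)` (11.8) (But see caution at end
of this section.)»; p. 338 after (11.9): «If the mapping `φ′ : ∂H → G` (11.9) is homotopically trivial we will use the same
*Geometric Construction 3*»; p. 339 «*Caution.* The geometric theorems of Appendix A, require a universal bound on `Λ₁` of
`φ`'s (as scaled to unit scale), to get started.»  TYPING (embedded reading, target a set `M ⊆ Rᵗ` with the ambient distance,
as all App. A files): for every cap `c₁` there is `c = c(c₁)` such that for every hypercube `D_ℓ` of side `ℓ > 0` and every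
homotopically trivial `φ′₁ : ∂D_ℓ → M` with `ℓ·Λ₁(φ′₁) ≤ c₁` (the scale-invariant cap) there is an extension to `D_ℓ` with
(11.7) and (11.8).  `Prop`-valued definition; = Theorem A.1 transported to the cube of side `ℓ` (proved below from
`ThmA1Emb`). [cite: Federbush1988PhaseCellIV, Geometric Construction 3 (11.7)–(11.8) p. 338; Caution p. 339] -/
def GeomConstruction3 (k t : ℕ) (M : Set (EuclideanSpace ℝ (Fin t))) : Prop :=
  ∀ c₁ : ℝ≥0, ∃ c : ℝ≥0, ∀ ℓ : ℝ, 0 < ℓ →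
    ∀ f : C(↥(scaledCubeBoundary k ℓ), ↥M), f.Nullhomotopic → ENNReal.ofReal ℓ * lipConst f ≤ c₁ →
      ∃ fe : ↥(scaledCube k ℓ) → ↥M,
        (∀ x : ↥(scaledCubeBoundary k ℓ), fe ⟨x.1, scaledCubeBoundary_subset k ℓ x.2⟩ = f x) ∧
        lipConst fe ≤ c * lipConst f

open GeomConstr GeomConstr3 in
/-- **Geometric Construction 3 DERIVED from Theorem A.1 (embedded reading)**: `ThmA1Emb k t M → GeomConstruction3 k t M` with
the same constant `c(c₁) = c₂(c₁)` — pull `φ′₁` back to the unit cube along `y ↦ ℓy` (`Λ₁` scales by `ℓ`, so the cap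
`ℓΛ₁(φ′₁) ≤ c₁` is exactly (A.1)), extend by Theorem A.1, push forward along `x ↦ ℓ⁻¹x` (`Λ₁` scales back by `ℓ⁻¹`); homotopic
triviality is transported along the homeomorphism. [cite: Federbush1988PhaseCellIV, Geometric Construction 3 (11.7)–(11.8) p. 338; Theorem A.1 p. 339] -/
theorem geomConstruction3_of_thmA1Emb {k t : ℕ} {M : Set (EuclideanSpace ℝ (Fin t))} (h : ThmA1Emb k t M) :
    GeomConstruction3 k t M := by
  intro c₁
  obtain ⟨c₂, H⟩ := h c₁
  refine ⟨c₂, fun ℓ hℓ f hf hcap => ?_⟩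
  set ℓ' : ℝ≥0 := Real.toNNReal ℓ with hℓ'
  have hℓ'pos : ℓ' ≠ 0 := by rw [hℓ']; exact (Real.toNNReal_pos.mpr hℓ).ne'
  have hℓ'coe : (ℓ' : ℝ) = ℓ := Real.coe_toNNReal _ hℓ.le
  -- the two dilations on the subtypes
  set up : C(↥(cubeBoundary k), ↥(scaledCubeBoundary k ℓ)) :=
    ⟨fun y => ⟨ℓ • y.1, (smul_mem_scaledCubeBoundary_iff hℓ y.1).mpr y.2⟩,
      ((continuous_const_smul ℓ).comp continuous_subtype_val).subtype_mk _⟩ with hup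
  have hupL : LipschitzWith ℓ' up := LipschitzWith.of_dist_le_mul fun y y' => by
    rw [Subtype.dist_eq, Subtype.dist_eq y]
    show dist (ℓ • y.1) (ℓ • y'.1) ≤ ℓ' * dist y.1 y'.1
    rw [dist_smul₀, Real.norm_of_nonneg hℓ.le, hℓ'coe]
  set down : ↥(scaledCube k ℓ) → ↥(unitCube k) :=
    fun x => ⟨ℓ⁻¹ • x.1, (mem_scaledCube_iff hℓ x.1).mp x.2⟩ with hdown
  have hdownL : LipschitzWith ℓ'⁻¹ down := LipschitzWith.of_dist_le_mul fun x x' => by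
    rw [Subtype.dist_eq, Subtype.dist_eq x]
    show dist (ℓ⁻¹ • x.1) (ℓ⁻¹ • x'.1) ≤ (ℓ'⁻¹ : ℝ≥0) * dist x.1 x'.1
    rw [dist_smul₀, Real.norm_of_nonneg (inv_nonneg.mpr hℓ.le), NNReal.coe_inv, hℓ'coe]
  -- Theorem A.1 for the pulled-back map
  set g : C(↥(cubeBoundary k), ↥M) := f.comp up with hg_def
  have hg : g.Nullhomotopic := hf.comp_left up
  have hgcap : lipConst (g : ↥(cubeBoundary k) → ↥M) ≤ c₁ := by
    calc lipConst (g : ↥(cubeBoundary k) → ↥M) ≤ (ℓ' : ℝ≥0∞) * lipConst (f : ↥(scaledCubeBoundary k ℓ) → ↥M) :=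
          lipConst_comp_le f hupL
      _ ≤ c₁ := by rwa [show (ℓ' : ℝ≥0∞) = ENNReal.ofReal ℓ from rfl]
  obtain ⟨ge, hge, hgeΛ⟩ := H g hg hgcap
  refine ⟨ge ∘ down, fun x => ?_, ?_⟩
  · -- (11.7)
    have hxb : ℓ⁻¹ • x.1 ∈ cubeBoundary k := (mem_scaledCubeBoundary_iff hℓ x.1).mp x.2
    have h1 : (ge ∘ down) ⟨x.1, scaledCubeBoundary_subset k ℓ x.2⟩ = ge ⟨ℓ⁻¹ • x.1, cubeBoundary_subset k hxb⟩ := rfl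
    have h3 : g ⟨ℓ⁻¹ • x.1, hxb⟩ = f x := by
      show f (up ⟨ℓ⁻¹ • x.1, hxb⟩) = f x
      congr 1
      apply Subtype.ext
      show ℓ • (ℓ⁻¹ • x.1) = x.1
      rw [smul_smul, mul_inv_cancel₀ hℓ.ne', one_smul]
    rw [h1, hge ⟨ℓ⁻¹ • x.1, hxb⟩, h3]
  · -- (11.8)
    calc lipConst (ge ∘ down) ≤ (ℓ'⁻¹ : ℝ≥0) * lipConst ge := lipConst_comp_le ge hdownL
      _ ≤ (ℓ'⁻¹ : ℝ≥0) * (c₂ * lipConst (g : ↥(cubeBoundary k) → ↥M)) := by gcongr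
      _ ≤ (ℓ'⁻¹ : ℝ≥0) * (c₂ * ((ℓ' : ℝ≥0∞) * lipConst (f : ↥(scaledCubeBoundary k ℓ) → ↥M))) := by
          gcongr
          exact lipConst_comp_le f hupL
      _ = c₂ * lipConst (f : ↥(scaledCubeBoundary k ℓ) → ↥M) := by
          rw [← mul_assoc, ← mul_assoc, mul_comm ((ℓ'⁻¹ : ℝ≥0) : ℝ≥0∞), mul_assoc (c₂ : ℝ≥0∞), ← ENNReal.coe_mul,
            inv_mul_cancel₀ hℓ'pos, ENNReal.coe_one, mul_one]

/-- **Geometric Construction 3 for every COMPACT uniformly Lipschitz-retractable `M ⊆ Rᵗ`**, every cube dimension `k`, every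
level (side `ℓ`). [cite: Federbush1988PhaseCellIV, Geometric Construction 3 (11.7)–(11.8) p. 338] -/
theorem geomConstruction3_of_retract {k t : ℕ} {M : Set (EuclideanSpace ℝ (Fin t))} {r : ℝ} {L : ℝ≥0}
    {P : EuclideanSpace ℝ (Fin t) → EuclideanSpace ℝ (Fin t)} (hM : IsCompact M) (hr : 0 < r)
    (hPL : LipschitzOnWith L P {y | infDist y M < r}) (hPM : MapsTo P {y | infDist y M < r} M)
    (hPid : ∀ y ∈ M, P y = y) : GeomConstruction3 k t M :=
  geomConstruction3_of_thmA1Emb (thmA1Emb_of_retract hM hr hPL hPM hPid k)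

/-- **Geometric Construction 3 for the model targets `S^{t−1}`** (so `U(1) = S¹`, `SU(2) ≅ S³`), hypothesis-free.
[cite: Federbush1988PhaseCellIV, Geometric Construction 3 (11.7)–(11.8) p. 338] -/
theorem geomConstruction3_sphere (k t : ℕ) : GeomConstruction3 k t (sphere (0 : EuclideanSpace ℝ (Fin t)) 1) :=
  geomConstruction3_of_thmA1Emb (thmA1Emb_sphere k t)

end PhaseCellIVAppA

end

end Literature.MathematicalPhysics.QuantumFieldTheory.Federbush1986
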